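import Literature.NumberTheory.EllipticCurves.InertiaTameFactorizationProofs
import Literature.NumberTheory.EllipticCurves.MultiplicativeUnramifiedTorsionProofs
import Literature.NumberTheory.EllipticCurves.GeomPointsGaloisModule
import Literature.NumberTheory.EllipticCurves.GreenbergSelmer
import Literature.NumberTheory.GaloisRepresentations.DecompositionGroupOfCompletion
import Literature.NumberTheory.GaloisRepresentations.IntegralGaloisActionProofs
import Mathlib.RingTheory.Frobenius
import HarnessLib

set_option autoImplicit false

-- the summit and its single problem are both named `BirchSwinnertonDyer` (registry layout D-0017)
set_option linter.dupNamespace false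

/-!
# Tame Kummer theory with a fixed generator, primitive Kummer values of a unipotent mover of `E[p²]`,
# and a normalising Frobenius (helpers for crux stmt-BirchSwinnertonDyer-20547 `KatoDivisibilityX9`, stub 3 (U))

Port (verbatim, re-homed) of §J3–§J5 of the bsd-f3-mu cell's kernel-checked sketch `Sketch71.lean` v5 f376123484d02b28
(planner-bsd-f3-mu-desc g71; standalone check `d71/J71a.lean` 4d4b53f927e74da5; port plan PORT-PLAN-72 file P4b, desc
g72).  These are the Galois-side inputs of the theorem «`ρ_D(I_𝔓)` is pro-cyclic through a tame generator modulo every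
`𝔪^j`» (`…ULedgerTameMonodromy.lean`):

* §J3 (general number field `K`, place `v`; namespace of this file) `forall_apply_eq_nsmul_of_isPrimitiveRoot` — a
  continuous homomorphism `a : I_𝔓 → T` to a finite discrete abelian group killed by `n`, `v ∤ n`, is cyclic through
  any `τ₁` whose Kummer value on an `n`-th root of a uniformizer is PRIMITIVE (the tree's
  `InertiaTame.exists_forall_apply_eq_nsmul` with the generator prescribed); `conj_smul_root_eq_pow_smul`;
* §J4 (namespace `WeierstrassCurve`, dot notation on `W : WeierstrassCurve K`) `smul_eq_of_smul_root_eq`,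
  `isPrimitiveRoot_smul_div_of_smul_ne` — at a multiplicative `v ∤ p` with `p ∣ ord_v Δ`, an inertia element moving
  `E[p²]` has primitive Kummer values at every level `p^j`;
* `continuous_of_isOpen_fibers` (a map to a discrete space with open fibres is continuous; §J1 of the sketch);
* §J5 `exists_frobenius_normalising` (over `ℚ`) — an arithmetic Frobenius at `𝔓 ∣ v` normalises `I_𝔓` and raises
  roots of unity of order prime to `v` to the `N(v)`-th power.

No ledger item is closed here; BSD is proved for no curve.  References: [SerreInventiones1972] §1.3 Prop. 2, n° 1.12;
[GrossLMS1991] proof of Prop. 7.5; [SerreAbelianLadic1968] Ch. I §2.1; [SerreLocalFields1979] Ch. IV §4 Prop. 16.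
-/

noncomputable section

open scoped Classical NumberField

universe u


/-! ## §J3. Kummer theory with a FIXED generator (tree `InertiaTameFactorizationProofs`, second half of
`exists_forall_apply_eq_nsmul` verbatim with `τ₁` given) -/

namespace Summit.BirchSwinnertonDyer.BirchSwinnertonDyer.Theorems.OneSidedTwistSqueezeX9KatoDivisibilityX9ULedger

section JKummer

/-- A map to a discrete space all of whose fibres are open is continuous. [folklore] -/
theorem continuous_of_isOpen_fibers {G T : Type*} [TopologicalSpace G] [TopologicalSpace T] (a : G → T)
    (h : ∀ g₀ : G, IsOpen {g | a g = a g₀}) : Continuous a := by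
  rw [continuous_def]
  intro U _
  rw [isOpen_iff_forall_mem_open]
  intro g₀ hg₀
  exact ⟨{g | a g = a g₀}, fun g hg => by simp only [Set.mem_preimage, Set.mem_setOf_eq] at hg ⊢; rw [hg]; exact hg₀,
    h g₀, rfl⟩

open NumberField IsDedekindDomain Field
open Literature Literature.NumberTheory.EllipticCurves Literature.NumberTheory.GaloisRepresentations
open Literature.NumberTheory.EllipticCurves.InertiaTame IsDedekindDomain.HeightOneSpectrum


variable {K : Type u} [Field K] [NumberField K] (v : HeightOneSpectrum (𝓞 K))

/-- **Cyclic image through a prescribed generator.**  `v ∤ n`, `z ^ n = π` a uniformizer at `v`, `a : I_𝔓 → T` a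
continuous homomorphism to a finite discrete abelian group killed by `n`, and `τ₁ ∈ I_𝔓` whose Kummer value
`θ_z(τ₁) = τ₁ z / z` is a PRIMITIVE `n`-th root of unity: then every `σ ∈ I_𝔓` has `a σ = k • a τ₁`.
[cite: SerreInventiones1972, §1.3 Prop. 2] [cite: GrossLMS1991, proof of Prop. 7.5] -/
theorem forall_apply_eq_nsmul_of_isPrimitiveRoot {n : ℕ} (hn : 0 < n)
    (hnv : (n : 𝓞 K) ∉ v.asIdeal) {π : K} (hπ : v.valuation K π = WithZero.exp (-1 : ℤ))
    {z : AlgebraicClosure K} (hz : z ^ n = algebraMap K (AlgebraicClosure K) π)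
    {𝔓 : Ideal (absIntegers (𝓞 K) K)} (h𝔓 : 𝔓 ∈ v.primesAbove)
    {T : Type*} [AddCommGroup T] [Finite T] [TopologicalSpace T] [DiscreteTopology T]
    (hT : ∀ t : T, n • t = 0)
    (a : 𝔓.inertia (absoluteGaloisGroup K) → T) (hac : Continuous a)
    (ha : ∀ σ τ, a (σ * τ) = a σ + a τ)
    {τ₁ : 𝔓.inertia (absoluteGaloisGroup K)} {ζ : AlgebraicClosure K} (hζ : IsPrimitiveRoot ζ n)
    (hτ₁z : (τ₁ : absoluteGaloisGroup K) • z = ζ * z) (σ : 𝔓.inertia (absoluteGaloisGroup K)) :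
    ∃ k : ℕ, a σ = k • a τ₁ := by
  have hz0 : z ≠ 0 := by
    intro h0
    rw [h0, zero_pow hn.ne', eq_comm, map_eq_zero] at hz
    rw [hz, map_zero] at hπ
    exact WithZero.coe_ne_zero hπ.symm
  have hπfix : (σ : absoluteGaloisGroup K) • algebraMap K (AlgebraicClosure K) π =
      algebraMap K (AlgebraicClosure K) π := by
    rw [absoluteGaloisGroup.smul_def, AlgEquiv.commutes]
  haveI : NeZero n := ⟨hn.ne'⟩
  obtain ⟨k, -, hk⟩ := hζ.eq_pow_of_pow_eq_one (smul_div_pow_eq_one hz hz0 hπfix)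
  refine ⟨k, ?_⟩
  have hpow : ∀ m : ℕ, ((τ₁ : absoluteGaloisGroup K) ^ m) • z = ζ ^ m * z := by
    intro m
    induction m with
    | zero => rw [pow_zero, one_smul, pow_zero, one_mul]
    | succ m ih =>
      rw [pow_succ', mul_smul, ih, smul_mul', hτ₁z,
        smul_eq_of_mem_inertia_of_pow_eq_one v hn hnv h𝔓 τ₁.2 (ζ := ζ ^ m)
          (by rw [← pow_mul, mul_comm, pow_mul, hζ.pow_eq_one, one_pow])]
      ring
  have h1 : (σ : absoluteGaloisGroup K) • z =
      ((τ₁ ^ k : 𝔓.inertia (absoluteGaloisGroup K)) : absoluteGaloisGroup K) • z := by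
    rw [Subgroup.coe_pow, hpow k, hk, div_mul_cancel₀ _ hz0]
  rw [apply_eq_apply_of_smul_root_eq v hn hnv hπ hz h𝔓 hT a hac ha h1, apply_pow_eq_nsmul a ha]

/-- **Tame conjugation law on roots**: for `τ ∈ I_𝔓`, `φ ∈ Γ_K` with `φ ζ = ζ^ℓ` on `n`-th roots of unity and
`z ^ n = π ∈ K`: `(φ τ φ⁻¹) z = (τ ^ ℓ) z`. [cite: SerreInventiones1972, §1.8 Prop. 6] -/
theorem conj_smul_root_eq_pow_smul {n : ℕ} (hn : 0 < n) (hnv : (n : 𝓞 K) ∉ v.asIdeal)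
    {π : K} {z : AlgebraicClosure K} (hz : z ^ n = algebraMap K (AlgebraicClosure K) π) (hz0 : z ≠ 0)
    {𝔓 : Ideal (absIntegers (𝓞 K) K)} (h𝔓 : 𝔓 ∈ v.primesAbove)
    {τ φ : absoluteGaloisGroup K} (hτ : τ ∈ 𝔓.inertia (absoluteGaloisGroup K)) {ℓ : ℕ}
    (hφ : ∀ ζ : AlgebraicClosure K, ζ ^ n = 1 → φ • ζ = ζ ^ ℓ) :
    (φ * τ * φ⁻¹) • z = (τ ^ ℓ) • z := by
  have hπfix : ∀ g : absoluteGaloisGroup K, g • algebraMap K (AlgebraicClosure K) π =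
      algebraMap K (AlgebraicClosure K) π := fun g => by
    rw [absoluteGaloisGroup.smul_def, AlgEquiv.commutes]
  -- `θ := τ z / z`, an `n`-th root of unity fixed by `τ`
  set θ : AlgebraicClosure K := τ • z / z with hθ
  have hθn : θ ^ n = 1 := smul_div_pow_eq_one hz hz0 (hπfix τ)
  have hτz : τ • z = θ * z := by rw [hθ, div_mul_cancel₀ _ hz0]
  have hτθ : ∀ m : ℕ, τ • θ ^ m = θ ^ m := fun m =>
    smul_eq_of_mem_inertia_of_pow_eq_one v hn hnv h𝔓 hτ (by rw [← pow_mul, mul_comm, pow_mul, hθn, one_pow])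
  have hpow : ∀ m : ℕ, (τ ^ m) • z = θ ^ m * z := by
    intro m
    induction m with
    | zero => rw [pow_zero, one_smul, pow_zero, one_mul]
    | succ m ih => rw [pow_succ', mul_smul, ih, smul_mul', hτz, hτθ]; ring
  -- `ζ' := φ⁻¹ z / z`, an `n`-th root of unity (fixed by `τ`)
  set ζ' : AlgebraicClosure K := φ⁻¹ • z / z with hζ'
  have hζ'n : ζ' ^ n = 1 := smul_div_pow_eq_one hz hz0 (hπfix φ⁻¹)
  have hφinvz : φ⁻¹ • z = ζ' * z := by rw [hζ', div_mul_cancel₀ _ hz0]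
  have hζ'0 : φ • ζ' ≠ 0 := by
    rw [hφ ζ' hζ'n]
    refine pow_ne_zero _ ?_
    intro h0; rw [h0, zero_pow hn.ne'] at hζ'n; exact zero_ne_one hζ'n
  -- `z = φ (φ⁻¹ z) = (φ ζ') (φ z)`, so `φ z = (φ ζ')⁻¹ z`
  have hφz : φ • z = (φ • ζ')⁻¹ * z := by
    have h3 : z = φ • ζ' * φ • z := by
      conv_lhs => rw [← smul_inv_smul φ z, hφinvz, smul_mul']
    rw [eq_inv_mul_iff_mul_eq₀ hζ'0, ← h3]
  rw [hpow, mul_smul, mul_smul, hφinvz, smul_mul', hτz, smul_eq_of_mem_inertia_of_pow_eq_one v hn hnv h𝔓 hτ hζ'n,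
    smul_mul', smul_mul', hφz, hφ θ hθn, ← mul_assoc, mul_comm (φ • ζ') (θ ^ ℓ), mul_assoc, mul_inv_cancel_left₀ hζ'0]

end JKummer

end Summit.BirchSwinnertonDyer.BirchSwinnertonDyer.Theorems.OneSidedTwistSqueezeX9KatoDivisibilityX9ULedger

/-! ## §J4. `E`-side: a unipotent mover of `E[p²]` has PRIMITIVE Kummer values at every level `p^j` -/

namespace WeierstrassCurve

open NumberField IsDedekindDomain Field
open Literature Literature.NumberTheory.EllipticCurves Literature.NumberTheory.GaloisRepresentations
open Literature.NumberTheory.EllipticCurves.InertiaTame IsDedekindDomain.HeightOneSpectrum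
open Summit.BirchSwinnertonDyer.BirchSwinnertonDyer.Theorems.OneSidedTwistSqueezeX9KatoDivisibilityX9ULedger


variable {K : Type u} [Field K] [NumberField K] {v : HeightOneSpectrum (𝓞 K)} (W : WeierstrassCurve K)

/-- **Triviality on a `p`-th root of a uniformizer forces triviality on `E[p²]`** at a multiplicative `v ∤ p` with
`p ∣ ord_v Δ`: the cocycle `σ ↦ (Q ↦ σ Q − Q) : I_𝔓 → Hom(E[p²], E[p])` is a continuous homomorphism killed by `p`, so
it factors through `θ_{z₁}` (`z₁ ^ p = π`); if `τ z₁ = z₁` then `τ` fixes `E[p²]`. [cite: SerreInventiones1972, §1.3 and n° 1.12] -/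
theorem smul_eq_of_smul_root_eq [W.IsElliptic] (hmult : W.HasMultiplicativeReductionAt v) {p : ℕ} (hp : p.Prime)
    (hpv : (p : 𝓞 K) ∉ v.asIdeal) (hdvd : p ∣ W.ordMinimalDiscriminant v)
    {𝔓 : Ideal (absIntegers (𝓞 K) K)} (h𝔓 : 𝔓 ∈ v.primesAbove)
    {τ : absoluteGaloisGroup K} (hτ : τ ∈ 𝔓.inertia (absoluteGaloisGroup K))
    {π : K} (hπ : v.valuation K π = WithZero.exp (-1 : ℤ)) {z₁ : AlgebraicClosure K}
    (hz₁ : z₁ ^ p = algebraMap K (AlgebraicClosure K) π) (hfix : τ • z₁ = z₁)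
    (Q : geomTorsion W ((p ^ 2 : ℕ) : ℤ)) : τ • Q = Q := by
  haveI : Fact p.Prime := ⟨hp⟩
  -- finiteness of the torsion
  haveI : Finite (geomTorsion W ((p ^ 2 : ℕ) : ℤ)) :=
    finite_torsionPoints_holds W (AlgebraicClosure K) (by exact_mod_cast (pow_ne_zero 2 hp.ne_zero))
  haveI : Finite (geomTorsion W (p : ℤ)) :=
    finite_torsionPoints_holds W (AlgebraicClosure K) (by exact_mod_cast hp.ne_zero)
  -- inertia fixes `E[p]`
  have hfixp : ∀ σ ∈ 𝔓.inertia (absoluteGaloisGroup K), ∀ P : geomPoints W, (p : ℤ) • P = 0 → σ • P = P := by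
    intro σ hσ P hP
    have := W.smul_geomTorsion_eq_of_mem_inertia_of_hasMultiplicativeReductionAt_of_dvd hmult hp hpv hdvd h𝔓 hσ
      ⟨P, (Submodule.mem_torsionBy_iff (p : ℤ) P).mpr hP⟩
    exact congrArg Subtype.val this
  -- the cocycle values `σ Q − Q` lie in `E[p]`
  have hmem : ∀ σ ∈ 𝔓.inertia (absoluteGaloisGroup K), ∀ Q : geomTorsion W ((p ^ 2 : ℕ) : ℤ),
      (p : ℤ) • (σ • (Q : geomPoints W) - Q) = 0 := by
    intro σ hσ Q
    have hQ : ((p ^ 2 : ℕ) : ℤ) • (Q : geomPoints W) = 0 := (Submodule.mem_torsionBy_iff _ Q.1).mp Q.2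
    have hpQ : (p : ℤ) • ((p : ℤ) • (Q : geomPoints W)) = 0 := by
      rw [smul_smul, show ((p : ℤ) * (p : ℤ)) = ((p ^ 2 : ℕ) : ℤ) by push_cast; ring]; exact hQ
    rw [smul_sub, smul_comm, hfixp σ hσ _ hpQ, sub_self]
  -- the cocycle
  let b : 𝔓.inertia (absoluteGaloisGroup K) → (geomTorsion W ((p ^ 2 : ℕ) : ℤ) → geomTorsion W (p : ℤ)) := fun σ Q =>
    ⟨(σ : absoluteGaloisGroup K) • (Q : geomPoints W) - Q, (Submodule.mem_torsionBy_iff (p : ℤ) _).mpr (hmem σ σ.2 Q)⟩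
  have hb : ∀ (σ : 𝔓.inertia (absoluteGaloisGroup K)) (Q : geomTorsion W ((p ^ 2 : ℕ) : ℤ)),
      ((b σ Q : geomTorsion W (p : ℤ)) : geomPoints W) = (σ : absoluteGaloisGroup K) • (Q : geomPoints W) - Q := fun _ _ => rfl
  letI : TopologicalSpace (geomTorsion W ((p ^ 2 : ℕ) : ℤ) → geomTorsion W (p : ℤ)) := ⊥
  haveI : DiscreteTopology (geomTorsion W ((p ^ 2 : ℕ) : ℤ) → geomTorsion W (p : ℤ)) := ⟨rfl⟩
  have hT : ∀ f : geomTorsion W ((p ^ 2 : ℕ) : ℤ) → geomTorsion W (p : ℤ), p • f = 0 := by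
    intro f; funext Q
    rw [Pi.smul_apply, Pi.zero_apply]
    apply Subtype.ext
    rw [AddSubmonoidClass.coe_nsmul, ZeroMemClass.coe_zero, ← natCast_zsmul]
    exact (Submodule.mem_torsionBy_iff (p : ℤ) (f Q).1).mp (f Q).2
  have ha : ∀ σ σ' : 𝔓.inertia (absoluteGaloisGroup K), b (σ * σ') = b σ + b σ' := by
    intro σ σ'; funext Q
    apply Subtype.ext
    rw [Pi.add_apply, AddSubgroup.coe_add, hb, hb, hb, Subgroup.coe_mul, mul_smul]
    have h1 : (σ : absoluteGaloisGroup K) • ((σ' : absoluteGaloisGroup K) • (Q : geomPoints W) - Q) = (σ' : absoluteGaloisGroup K) • (Q : geomPoints W) - Q :=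
      hfixp σ σ.2 _ (hmem σ' σ'.2 Q)
    rw [smul_sub] at h1
    -- `σ σ' Q − Q = (σ σ' Q − σ Q) + (σ Q − Q) = (σ' Q − Q) + (σ Q − Q)`
    calc (σ : absoluteGaloisGroup K) • (σ' : absoluteGaloisGroup K) • (Q : geomPoints W) - Q
        = ((σ : absoluteGaloisGroup K) • (σ' : absoluteGaloisGroup K) • (Q : geomPoints W) - (σ : absoluteGaloisGroup K) • (Q : geomPoints W)) + ((σ : absoluteGaloisGroup K) • (Q : geomPoints W) - Q) := by
          abel
      _ = ((σ' : absoluteGaloisGroup K) • (Q : geomPoints W) - Q) + ((σ : absoluteGaloisGroup K) • (Q : geomPoints W) - Q) := by rw [h1]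
      _ = ((σ : absoluteGaloisGroup K) • (Q : geomPoints W) - Q) + ((σ' : absoluteGaloisGroup K) • (Q : geomPoints W) - Q) := add_comm _ _
  have hac : Continuous b := by
    refine continuous_of_isOpen_fibers b fun σ₀ => ?_
    have hU : IsOpen {σ : absoluteGaloisGroup K | ∀ Q : geomTorsion W ((p ^ 2 : ℕ) : ℤ), σ • Q = (σ₀ : absoluteGaloisGroup K) • Q} := by
      have e : {σ : absoluteGaloisGroup K | ∀ Q : geomTorsion W ((p ^ 2 : ℕ) : ℤ), σ • Q = (σ₀ : absoluteGaloisGroup K) • Q} =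
          ⋂ Q : geomTorsion W ((p ^ 2 : ℕ) : ℤ),
            (fun σ : absoluteGaloisGroup K => (σ₀ : absoluteGaloisGroup K)⁻¹ * σ) ⁻¹' ((MulAction.stabilizer (absoluteGaloisGroup K) Q : Subgroup (absoluteGaloisGroup K)) : Set (absoluteGaloisGroup K)) := by
        ext σ
        simp only [Set.mem_setOf_eq, Set.mem_iInter, Set.mem_preimage, SetLike.mem_coe, MulAction.mem_stabilizer_iff,
          mul_smul, inv_smul_eq_iff]
      rw [e]
      exact isOpen_iInter_of_finite fun Q =>
        (isOpen_stabilizer_geomTorsion W _ Q).preimage (continuous_const_mul _)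
    have e2 : {σ : 𝔓.inertia (absoluteGaloisGroup K) | b σ = b σ₀} =
        Subtype.val ⁻¹' {σ : absoluteGaloisGroup K | ∀ Q : geomTorsion W ((p ^ 2 : ℕ) : ℤ), σ • Q = (σ₀ : absoluteGaloisGroup K) • Q} := by
      ext σ
      simp only [Set.mem_setOf_eq, Set.mem_preimage, funext_iff]
      refine forall_congr' fun Q => ?_
      rw [Subtype.ext_iff, hb, hb, sub_left_inj, Subtype.ext_iff,
        Literature.NumberTheory.EllipticCurves.AddSubgroup.torsionBy.coe_smul,
        Literature.NumberTheory.EllipticCurves.AddSubgroup.torsionBy.coe_smul]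
    rw [e2]
    exact hU.preimage continuous_subtype_val
  -- apply the Kummer factorisation at level `p`: `τ z₁ = 1 z₁` ⟹ `b τ = b 1 = 0`
  have hb1 : b 1 = 0 := by
    have := ha 1 1
    rw [mul_one] at this
    exact left_eq_add.mp this
  have key := apply_eq_apply_of_smul_root_eq v hp.pos hpv hπ hz₁ h𝔓 hT b hac ha (σ := ⟨τ, hτ⟩) (σ' := 1)
    (by rw [Subgroup.coe_mk, Subgroup.coe_one, one_smul, hfix])
  rw [hb1] at key
  have hQ := congrArg (fun f => ((f Q : geomTorsion W (p : ℤ)) : geomPoints W)) key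
  simp only [hb, Pi.zero_apply, ZeroMemClass.coe_zero, sub_eq_zero] at hQ
  exact Subtype.ext (by rw [Literature.NumberTheory.EllipticCurves.AddSubgroup.torsionBy.coe_smul]; exact hQ)

/-- **PRIMITIVITY.**  At a multiplicative `v ∤ p` with `p ∣ ord_v Δ`, an inertia element `τ ∈ I_𝔓` moving `E[p²]`
has Kummer value `θ_z(τ) = τ z / z` a PRIMITIVE `p^j`-th root of unity for every `j ≥ 1` and every `z` with
`z ^ (p^j) = π` (`π` a uniformizer at `v`): otherwise `τ` fixes `z^{p^{j-1}}`, a `p`-th root of `π`, hence `E[p²]`.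
[cite: SerreInventiones1972, §1.3 and n° 1.12] -/
theorem isPrimitiveRoot_smul_div_of_smul_ne [W.IsElliptic] (hmult : W.HasMultiplicativeReductionAt v) {p : ℕ}
    (hp : p.Prime) (hpv : (p : 𝓞 K) ∉ v.asIdeal) (hdvd : p ∣ W.ordMinimalDiscriminant v)
    {𝔓 : Ideal (absIntegers (𝓞 K) K)} (h𝔓 : 𝔓 ∈ v.primesAbove)
    {τ : absoluteGaloisGroup K} (hτ : τ ∈ 𝔓.inertia (absoluteGaloisGroup K))
    (hmov : ∃ Q : geomTorsion W ((p ^ 2 : ℕ) : ℤ), τ • Q ≠ Q)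
    {π : K} (hπ : v.valuation K π = WithZero.exp (-1 : ℤ)) {j : ℕ} (hj : 1 ≤ j) {z : AlgebraicClosure K}
    (hz : z ^ (p ^ j) = algebraMap K (AlgebraicClosure K) π) : IsPrimitiveRoot (τ • z / z) (p ^ j) := by
  have hz0 : z ≠ 0 := by
    intro h0
    rw [h0, zero_pow (pow_ne_zero j hp.ne_zero), eq_comm, map_eq_zero] at hz
    rw [hz, map_zero] at hπ
    exact WithZero.coe_ne_zero hπ.symm
  have hπfix : τ • algebraMap K (AlgebraicClosure K) π = algebraMap K (AlgebraicClosure K) π := by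
    rw [absoluteGaloisGroup.smul_def, AlgEquiv.commutes]
  set θ := τ • z / z with hθ
  have hθn : θ ^ (p ^ j) = 1 := smul_div_pow_eq_one hz hz0 hπfix
  by_contra hnot
  -- the order of `θ` is `p^i` with `i < j`
  haveI : Fact p.Prime := ⟨hp⟩
  obtain ⟨i, hij, hi⟩ := (Nat.dvd_prime_pow hp).mp (orderOf_dvd_of_pow_eq_one hθn)
  have hij' : i < j := by
    rcases hij.lt_or_eq with h | h
    · exact h
    · exact (hnot (by rw [← h, ← hi]; exact IsPrimitiveRoot.orderOf θ)).elim
  have hθ1 : θ ^ (p ^ (j - 1)) = 1 :=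
    orderOf_dvd_iff_pow_eq_one.mp (hi ▸ pow_dvd_pow p (by omega))
  -- `z₁ := z^{p^{j-1}}` is a `p`-th root of `π` fixed by `τ`
  set z₁ := z ^ (p ^ (j - 1)) with hz₁
  have hz₁p : z₁ ^ p = algebraMap K (AlgebraicClosure K) π := by
    rw [hz₁, ← pow_mul, ← pow_succ, Nat.sub_add_cancel hj, hz]
  have hτz : τ • z = θ * z := by rw [hθ, div_mul_cancel₀ _ hz0]
  have hfix : τ • z₁ = z₁ := by
    rw [hz₁, smul_pow', hτz, mul_pow, hθ1, one_mul]
  obtain ⟨Q, hQ⟩ := hmov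
  exact hQ (W.smul_eq_of_smul_root_eq hmult hp hpv hdvd h𝔓 hτ hπ hz₁p hfix Q)

end WeierstrassCurve

/-! ## §J5. The family side: `ρ_D(I_𝔓)` is pro-cyclic through `τ` modulo every `𝔪^j` -/

namespace Summit.BirchSwinnertonDyer.BirchSwinnertonDyer.Theorems.OneSidedTwistSqueezeX9KatoDivisibilityX9ULedger

section JFrobenius

open NumberField IsDedekindDomain Field
open Literature Literature.NumberTheory.EllipticCurves Literature.NumberTheory.GaloisRepresentations
open IsDedekindDomain.HeightOneSpectrum

/-- **An arithmetic Frobenius at `𝔓 ∣ v` normalises `I_𝔓` and raises the roots of unity of order prime to `v` to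
the `N(v)`-th power** (tree: `exists_isArithFrobAt_of_mem_primesAbove_holds`; Mathlib `IsArithFrobAt.apply_of_pow_eq_one`,
`IsArithFrobAt.comap_eq`). [cite: SerreAbelianLadic1968, Ch. I §2.1] [cite: SerreLocalFields1979, Ch. IV §4 Prop. 16] -/
theorem exists_frobenius_normalising {v : HeightOneSpectrum (𝓞 ℚ)} {𝔓 : Ideal (absIntegers (𝓞 ℚ) ℚ)}
    (h𝔓 : 𝔓 ∈ v.primesAbove) :
    ∃ φ : absoluteGaloisGroup ℚ,
      (∀ σ ∈ 𝔓.inertia (absoluteGaloisGroup ℚ), φ * σ * φ⁻¹ ∈ 𝔓.inertia (absoluteGaloisGroup ℚ)) ∧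
      ∀ n : ℕ, (n : 𝓞 ℚ) ∉ v.asIdeal → ∀ ζ : AlgebraicClosure ℚ, ζ ^ n = 1 → φ • ζ = ζ ^ v.residueCard := by
  obtain ⟨φ, hφ⟩ := exists_isArithFrobAt_of_mem_primesAbove_holds (K := ℚ) (v := v) h𝔓
  haveI : 𝔓.IsPrime := h𝔓.1
  have hst : ∀ w : absIntegers (𝓞 ℚ) ℚ, w ∈ 𝔓 ↔ φ • w ∈ 𝔓 := fun w => by
    have h := (Ideal.mem_comap (f := MulSemiringAction.toAlgHom (𝓞 ℚ) (absIntegers (𝓞 ℚ) ℚ) φ) (K := 𝔓) (x := w))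
    rw [hφ.comap_eq, MulSemiringAction.toAlgHom_apply] at h
    exact h
  refine ⟨φ, fun σ hσ => ?_, fun n hnv ζ hζ => ?_⟩
  · intro x
    have e : (φ * σ * φ⁻¹) • x - x = φ • (σ • φ⁻¹ • x - φ⁻¹ • x) := by rw [smul_sub, smul_inv_smul, mul_smul, mul_smul]
    rw [e]
    exact (hst _).mp (hσ (φ⁻¹ • x))
  · have hn0 : 0 < n := Nat.pos_of_ne_zero (by rintro rfl; exact hnv (by rw [Nat.cast_zero]; exact zero_mem _))
    have hint : IsIntegral (𝓞 ℚ) ζ := IsIntegral.of_pow hn0 (by rw [hζ]; exact isIntegral_one)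
    let ζ' : absIntegers (𝓞 ℚ) ℚ := ⟨ζ, hint⟩
    have hζ' : ζ' ^ n = 1 := Subtype.ext (by rw [SubmonoidClass.coe_pow, OneMemClass.coe_one]; exact hζ)
    have hk' : (n : absIntegers (𝓞 ℚ) ℚ) ∉ 𝔓 := by
      intro h
      apply hnv
      rw [h𝔓.2.over, Ideal.under, Ideal.mem_comap, map_natCast]
      exact h
    have key := hφ.apply_of_pow_eq_one hζ' hk'
    rw [MulSemiringAction.toAlgHom_apply, card_quotient_under_eq_residueCard h𝔓] at key
    have := congrArg (fun w : absIntegers (𝓞 ℚ) ℚ => (w : AlgebraicClosure ℚ)) key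
    simpa only [integralClosure.coe_smul, SubmonoidClass.coe_pow] using this

end JFrobenius

end Summit.BirchSwinnertonDyer.BirchSwinnertonDyer.Theorems.OneSidedTwistSqueezeX9KatoDivisibilityX9ULedger
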